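import Mathlib
import Summits.QuantumFields.YangMills.Theorems.GuardedThresholdRemovalGuardedTransferCollar
import Summits.QuantumFields.YangMills.Theorems.GuardedThresholdRemovalThinSetTransfer
import Summits.QuantumFields.YangMills.Theses.GuardedThresholdRemoval

/-!
# `GuardedTransfer` (route GuardedThresholdRemoval, crux r3, stmt-QuantumFields-28026) — PROVED (part 2 of 2)

THE ONE-STEP NESTING TRANSFER OF THE CONTINUUM LIMIT AT THE PRINTED, DISCONTINUOUS SMALL-FIELD AVERAGING `ℰp = expMeanLogSU`:
if the once-refined family `F.refine 1` at coupling `γL⁻¹` has GUARD-THIN unit laws (uniformly in the cut-off `K`, vanishing mass in the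
`η`-collars `{u : ∃ c i, |dist₁(W_{c,i}(u)) − δ| < η}` of the guard spheres of the one-step (0.4) loops of the averaging `T₁ → T_L`) and has
the continuum limit `ContinuumYM3Torus (F.refine 1) ℰp (γL⁻¹)`, then `ContinuumYM3Torus F ℰp γ` (`guardedTransfer_proof`).

## The argument (Billingsley's mapping theorem [Billingsley1999, Thm 2.7 p. 25] made elementary)

* Part 1 (`…GuardedTransferCollar`): for every `η > 0` a CONTINUOUS small-loop average `ℰ_η` with the radius of `ℰp`, equal to the printed
  operation on families with all `dist₁ ≤ δ − η` and to `1` off the guard; block averaging by it is continuous, so the original strings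
  `coarseObs F 1 ℰ_η Cs` are continuous functions of the refined unit field.
* §3 Off the `η`-collar the block averagings of `ℰ_η` and `ℰp` COINCIDE (`avgFun_eq_of_offCollar`), hence so do the strings
  (`coarseObs_one_eq_of_offCollar`; the loops of the two towers' matched levels correspond, tree `loopHol_fieldShift`).
* §4/§5 Lévy's density theorem + ε/3 at an ARBITRARY measurable small-loop average (landed as
  `ThinSetTransfer.exists_tendsto_integral_unitLaw_of_measurableE`, file `…GuardedThresholdRemovalThinSetTransfer`): `HasContinuumLimit` of
  the refined scheme ⇒ `∫ f d(unitLaw K)` converges for every continuous gauge-invariant bounded measurable `f`.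
* §5 ε/3 with the thinness hypothesis: `|∫ coarseObs_{ℰp} − ∫ coarseObs_{ℰ_η}| ≤ 2·unitLaw_K(collar) ≤ 2ε` for `K ≥ K₀`, so the original
  scheme's expectations at steps `K + 1` (`expectAt_refine`) converge; on `SU(2)` existence is the whole content of `ContinuumYM3Torus`
  (`continuumYM3Torus_iff_hasContinuumLimit_SU`).

HONEST FRAMING.  A CONDITIONAL transfer (weak-convergence bookkeeping): it proves no instance of `ContinuumYM3Torus`, no thinness
(those are the route's cruxes `PrintShapeRecord` / `GuardSphereThin`), and nothing about the YM mass gap (route GuardedThresholdRemoval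
closes the RECORD rung R3 only, and only given its other cruxes).
-/

noncomputable section

open MeasureTheory Filter Topology NormedSpace
open scoped BigOperators Matrix.Norms.L2Operator
open Literature.MathematicalPhysics.QuantumFieldTheory.Balaban1983to89
open Literature.MathematicalPhysics.QuantumFieldTheory.Balaban1983to89.ExpMeanLog
open Literature.MathematicalPhysics.QuantumFieldTheory.Balaban1983to89.MatrixLog (mlog)
open Literature.MathematicalPhysics.QuantumFieldTheory.Balaban1983to89.T3ContinuumYM3Torus
open Literature.MathematicalPhysics.QuantumFieldTheory.Balaban1983to89.T3LevelShift
open Literature.MathematicalPhysics.QuantumFieldTheory.Balaban1983to89.T3ThresholdRemoval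
open Literature.MathematicalPhysics.QuantumFieldTheory.Balaban1983to89.T3UnitLawDensityEML
open Literature.MathematicalPhysics.QuantumFieldTheory.Balaban1983to89.Missing
open Literature.MathematicalPhysics.QuantumFieldTheory.Balaban1983to89.T4Continuum

namespace Summit.QuantumFields.YangMills.Theorems.GuardedTransfer

/-! ## §3 Off the `η`-collar the block averagings of `ℰ_η` and of the printed `ℰp` coincide -/

section Agreement

variable {n : Type} [Fintype n] [DecidableEq n] [Nonempty n]
variable (ℰ' : LoopAverage (Matrix.specialUnitaryGroup n ℂ)) {η : ℝ}

/-- If `ℰ'` has the radius of `expMeanLogSU` and the printed operation on families with all `dist₁ ≤ δ_N − η`, then at every coarse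
bond whose (0.4) loop variables all avoid the collar `|dist₁ − δ_N| < η` the two block averagings AGREE. [cite: Balaban1987RG1, (0.4) p.253] -/
theorem avgFun_eq_of_offCollar (hδ : ℰ'.δ = (expMeanLogSU (n := n)).δ)
    (hE : ∀ (m : ℕ) (W : Fin (m + 1) → Matrix.specialUnitaryGroup n ℂ),
      (∀ i, dist1 (W i) ≤ (expMeanLogSU (n := n)).δ - η) → ℰ'.E W = (expMeanLogSU (n := n)).E W)
    {P : Params} {j : ℕ} (U : GaugeField P j (Matrix.specialUnitaryGroup n ℂ)) (c : PBond P (j + 1))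
    (hoff : ∀ i, η ≤ |dist1 (BlockAveraging.loopHol U c i) - (expMeanLogSU (n := n)).δ|) :
    BlockAveraging.avgFun ℰ' U c = BlockAveraging.avgFun (expMeanLogSU (n := n)) U c := by
  have hcorr : BlockAveraging.corr ℰ' U c = BlockAveraging.corr (expMeanLogSU (n := n)) U c := by
    unfold BlockAveraging.corr
    by_cases hs : BlockAveraging.Small (expMeanLogSU (n := n)) U c
    · have hs' : BlockAveraging.Small ℰ' U c := fun i => by rw [hδ]; exact hs i
      rw [if_pos hs', if_pos hs]
      unfold LoopAverage.avg
      refine hE _ _ fun k => ?_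
      have hlt := hs ((LoopAverage.enum (BlockAveraging.Idx P)).symm k)
      have hge := hoff ((LoopAverage.enum (BlockAveraging.Idx P)).symm k)
      rw [abs_of_neg (sub_neg.mpr hlt)] at hge
      show dist1 (BlockAveraging.loopHol U c ((LoopAverage.enum (BlockAveraging.Idx P)).symm k)) ≤ _
      linarith
    · have hs' : ¬ BlockAveraging.Small ℰ' U c := fun h => hs fun i => by rw [← hδ]; exact h i
      rw [if_neg hs', if_neg hs]
  show BlockAveraging.corr ℰ' U c * AveragingRT.axialAvg U c =
    BlockAveraging.corr (expMeanLogSU (n := n)) U c * AveragingRT.axialAvg U c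
  rw [hcorr]

end Agreement

/-- **Off the `η`-collar of the refined unit torus the ORIGINAL STRINGS read through `ℰ'` and through `ℰp` coincide** (`n = 1`:
one more averaging `T₁ → T_L`; the loops of (0.4) at the two towers' matched levels correspond, tree `loopHol_fieldShift`).
[cite: Balaban1987RG1, (0.4) p.253] -/
theorem coarseObs_one_eq_of_offCollar (ℰ' : LoopAverage (Matrix.specialUnitaryGroup (Fin 2) ℂ)) {η : ℝ}
    (hδ : ℰ'.δ = (ℰp).δ)
    (hE : ∀ (m : ℕ) (W : Fin (m + 1) → Matrix.specialUnitaryGroup (Fin 2) ℂ),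
      (∀ i, dist1 (W i) ≤ (ℰp).δ - η) → ℰ'.E W = (ℰp).E W)
    (F : T3Family) (Cs : List (ULoop3 F)) (u : GaugeField ((F.refine 1).P 0) 0 (Matrix.specialUnitaryGroup (Fin 2) ℂ))
    (hoff : ∀ (c : PBond ((F.refine 1).P 0) 1) (i : BlockAveraging.Idx ((F.refine 1).P 0)),
      η ≤ |dist1 (BlockAveraging.loopHol u c i) - (ℰp).δ|) :
    coarseObs F 1 ℰ' Cs u = coarseObs F 1 ℰp Cs u := by
  -- the once-averaged fields agree
  have h₁ : (F.PP F.m 1).sitesPerDir (0 + 1) = (F.PP (F.m + 1) 0).sitesPerDir (0 + 1) := F.sitesPerDir_eq (by omega)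
  have havg : BlockAveraging.avgFun ℰ' (fieldShift (sitesPerDir_refine_unit F 1) u) =
      BlockAveraging.avgFun ℰp (fieldShift (sitesPerDir_refine_unit F 1) u) := by
    funext c'
    refine avgFun_eq_of_offCollar ℰ' hδ hE _ c' fun i => ?_
    rw [loopHol_fieldShift (sitesPerDir_refine_unit F 1) h₁]
    exact hoff _ i
  unfold coarseObs
  congr 1
  refine List.map_congr_left fun C _ => ?_
  show loopAt ((BlockAveraging.blockAvg ℰ').avg (fieldShift (sitesPerDir_refine_unit F 1) u)) (C.1.atLevel 1) =
    loopAt ((BlockAveraging.blockAvg ℰp).avg (fieldShift (sitesPerDir_refine_unit F 1) u)) (C.1.atLevel 1)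
  rw [BlockAveraging.blockAvg_avg, BlockAveraging.blockAvg_avg, havg]

/-! ## §4 ε/3, eventually -/

section Approx

/-- A real sequence approximable to every accuracy, EVENTUALLY, by convergent sequences converges (Cauchy, `ℝ` complete; the tree's
`T3ThresholdRemoval` §5 helper with «for all `K`» weakened to «for `K ≥ K₀`»; private there and in `…ThinSetTransfer`). [folklore] -/
private theorem exists_tendsto_of_forall_approx_eventually {a : ℕ → ℝ}
    (h : ∀ ε > 0, ∃ b : ℕ → ℝ, (∃ l, Tendsto b atTop (𝓝 l)) ∧ ∃ K₀ : ℕ, ∀ K, K₀ ≤ K → |a K - b K| ≤ ε) :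
    ∃ l, Tendsto a atTop (𝓝 l) := by
  apply cauchySeq_tendsto_of_complete
  rw [Metric.cauchySeq_iff]
  intro ε hε
  obtain ⟨b, ⟨l, hb⟩, K₀, hab⟩ := h (ε / 3) (by positivity)
  obtain ⟨N, hN⟩ := Metric.cauchySeq_iff.mp hb.cauchySeq (ε / 3) (by positivity)
  refine ⟨max N K₀, fun p hp q hq => ?_⟩
  have h1 := hab p (le_of_max_le_right hp)
  have h2 := hab q (le_of_max_le_right hq)
  have h3 := hN p (le_of_max_le_left hp) q (le_of_max_le_left hq)
  rw [Real.dist_eq] at h3 ⊢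
  calc |a p - a q| = |(a p - b p) + (b p - b q) + (b q - a q)| := by ring_nf
    _ ≤ |a p - b p| + |b p - b q| + |b q - a q| := abs_add_three _ _ _
    _ < ε := by rw [abs_sub_comm (b q) (a q)]; linarith

end Approx

/-! ## §5 The theorem -/

section Main

/-- The `η`-collar of the guard spheres of the one-step (0.4) loops on a lattice is a measurable event (finitely many loops; `dist₁`
and holonomies measurable). [folklore] -/
theorem measurableSet_collar {P : Params} {j : ℕ} (δ η : ℝ) :
    MeasurableSet {u : GaugeField P j (Matrix.specialUnitaryGroup (Fin 2) ℂ) |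
      ∃ (c : PBond P (j + 1)) (i : BlockAveraging.Idx P), |dist1 (BlockAveraging.loopHol u c i) - δ| < η} := by
  have hset : {u : GaugeField P j (Matrix.specialUnitaryGroup (Fin 2) ℂ) |
      ∃ (c : PBond P (j + 1)) (i : BlockAveraging.Idx P), |dist1 (BlockAveraging.loopHol u c i) - δ| < η} =
      ⋃ (c : PBond P (j + 1)), ⋃ (i : BlockAveraging.Idx P),
        {u | |dist1 (BlockAveraging.loopHol u c i) - δ| < η} := by
    ext u; simp
  rw [hset]
  refine MeasurableSet.iUnion fun c => MeasurableSet.iUnion fun i => ?_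
  exact measurableSet_lt ((RegularGaugeGroup.measurable_dist1.comp
    ((measurable_pi_apply i).comp (BlockAveraging.measurable_loopHol c))).sub_const δ |>.abs) measurable_const

/-- **`GuardedTransfer` (route GuardedThresholdRemoval, crux r3) — PROVED.**  For every family `F` and `γ > 0`: if the once-refined
family `F.refine 1` at coupling `γL⁻¹` has guard-thin unit laws at the printed averaging `ℰp` and `ContinuumYM3Torus (F.refine 1) ℰp (γL⁻¹)`,
then `ContinuumYM3Torus F ℰp γ`.  Proof: §§1–4 and ε/3 — for each accuracy `ε` the thinness supplies a collar width `η` and a `K₀`;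
the continuous collar-modified average `ℰ_η` of §1 reads the same strings off the collar (§3), its strings have convergent integrals by
Lévy + the hypothesis (§4, §2), and the two differ in integral by at most `2·unitLaw_K(collar) ≤ 2ε` for `K ≥ K₀`; the original
scheme's expectations at steps `K + 1` are these integrals (`expectAt_refine`), so they converge; existence is the whole content of
`ContinuumYM3Torus` on `SU(2)` (`continuumYM3Torus_iff_hasContinuumLimit_SU`).  Billingsley's mapping theorem [Billingsley1999, Thm 2.7
p.25] in elementary dress; no instance of the hypotheses is proved here. [cite: Billingsley1999, Thm 2.7 p.25] -/
theorem guardedTransfer_proof : Summit.QuantumFields.YangMills.Theses.GuardedThresholdRemoval.GuardedTransfer := by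
  intro F γ hγ hthin hcont
  have hγ' : 0 ≤ γ * ((F.L : ℝ)⁻¹) ^ 1 := mul_nonneg hγ.le (pow_nonneg (inv_nonneg.mpr (Nat.cast_nonneg _)) _)
  -- existence is the whole content on `SU(2)`
  refine (continuumYM3Torus_iff_hasContinuumLimit_SU F ℰp measurableE_ℰp hγ.le).mpr fun Cs => ?_
  have hlim : HasContinuumLimit ((F.refine 1).scheme ℰp (γ * ((F.L : ℝ)⁻¹) ^ 1)) :=
    ((continuumYM3Torus_iff_hasContinuumLimit_SU (F.refine 1) ℰp measurableE_ℰp hγ').mp hcont)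
  -- the unit laws of the refined family
  let μ : ℕ → Measure (GaugeField ((F.refine 1).P 0) 0 (Matrix.specialUnitaryGroup (Fin 2) ℂ)) :=
    fun K => (F.refine 1).unitLaw ℰp measurableE_ℰp (γ * ((F.L : ℝ)⁻¹) ^ 1) K
  haveI hμ : ∀ K, IsProbabilityMeasure (μ K) := fun K => isProbabilityMeasure_unitLaw measurableE_ℰp hγ' K
  -- the original expectations at steps `K + 1` are integrals of `coarseObs` against `μ K`
  suffices hsuff : ∃ l, Tendsto (fun K => ∫ u, coarseObs F 1 ℰp Cs u ∂μ K) atTop (𝓝 l) by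
    obtain ⟨l, hl⟩ := hsuff
    refine ⟨l, (tendsto_add_atTop_iff_nat 1).mp ?_⟩
    have hkey : (fun K => (F.scheme ℰp γ).expectAt (K + 1) Cs) = fun K => ∫ u, coarseObs F 1 ℰp Cs u ∂μ K :=
      funext fun K => expectAt_refine F 1 ℰp measurableE_ℰp hγ.le K Cs
    rw [hkey]
    exact hl
  -- ε/3 with the thinness hypothesis
  refine exists_tendsto_of_forall_approx_eventually fun ε hε => ?_
  obtain ⟨η, hη, K₀, hK₀⟩ := hthin (ε / 2) (half_pos hε)
  -- the continuous collar-modified small-loop average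
  obtain ⟨ℰ', hδ, hc, hE, h1⟩ := exists_collar_loopAverage (n := Fin 2) hη
  have hE' : ℰ'.MeasurableE := measurableE_of_continuous ℰ' hc
  -- its strings have convergent integrals (Lévy + the hypothesis)
  obtain ⟨l, hl⟩ := ThinSetTransfer.exists_tendsto_integral_unitLaw_of_measurableE (F.refine 1) ℰp measurableE_ℰp hγ' hlim
    (continuous_coarseObs_of ℰ' h1 hc F 1 Cs) (coarseObs_gaugeAct F 1 ℰ' Cs) (measurable_coarseObs F 1 ℰ' hE' Cs)
    (abs_coarseObs_le_one F 1 ℰ' Cs)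
  refine ⟨fun K => ∫ u, coarseObs F 1 ℰ' Cs u ∂μ K, ⟨l, hl⟩, K₀, fun K hK => ?_⟩
  -- the two strings differ only on the collar, where both are bounded by `1`
  have hcollar := hK₀ K hK
  set N : Set (GaugeField ((F.refine 1).P 0) 0 (Matrix.specialUnitaryGroup (Fin 2) ℂ)) :=
    {u | ∃ (c : PBond ((F.refine 1).P 0) 1) (i : BlockAveraging.Idx ((F.refine 1).P 0)),
      |dist1 (BlockAveraging.loopHol u c i) - (ℰp).δ| < η} with hN
  have hNm : MeasurableSet N := measurableSet_collar (ℰp).δ η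
  have hptw : ∀ u, |coarseObs F 1 ℰp Cs u - coarseObs F 1 ℰ' Cs u| ≤ N.indicator (fun _ => (2 : ℝ)) u := by
    intro u
    by_cases hu : u ∈ N
    · rw [Set.indicator_of_mem hu]
      calc |coarseObs F 1 ℰp Cs u - coarseObs F 1 ℰ' Cs u|
          ≤ |coarseObs F 1 ℰp Cs u| + |coarseObs F 1 ℰ' Cs u| := abs_sub _ _
        _ ≤ 1 + 1 := add_le_add (abs_coarseObs_le_one F 1 ℰp Cs u) (abs_coarseObs_le_one F 1 ℰ' Cs u)
        _ = 2 := by norm_num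
    · rw [Set.indicator_of_notMem hu]
      have hoff : ∀ (c : PBond ((F.refine 1).P 0) 1) (i : BlockAveraging.Idx ((F.refine 1).P 0)),
          η ≤ |dist1 (BlockAveraging.loopHol u c i) - (ℰp).δ| := fun c i => by
        by_contra hlt
        exact hu ⟨c, i, not_le.mp hlt⟩
      rw [coarseObs_one_eq_of_offCollar ℰ' hδ hE F Cs u hoff, sub_self, abs_zero]
  have hint : Integrable (fun u => coarseObs F 1 ℰp Cs u - coarseObs F 1 ℰ' Cs u) (μ K) :=
    (T4VarianceMatching.integrable_of_abs_le (μ K) (measurable_coarseObs F 1 ℰp measurableE_ℰp Cs)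
      (abs_coarseObs_le_one F 1 ℰp Cs)).sub
    (T4VarianceMatching.integrable_of_abs_le (μ K) (measurable_coarseObs F 1 ℰ' hE' Cs) (abs_coarseObs_le_one F 1 ℰ' Cs))
  calc |∫ u, coarseObs F 1 ℰp Cs u ∂μ K - ∫ u, coarseObs F 1 ℰ' Cs u ∂μ K|
      = |∫ u, (coarseObs F 1 ℰp Cs u - coarseObs F 1 ℰ' Cs u) ∂μ K| := by
        rw [integral_sub (T4VarianceMatching.integrable_of_abs_le (μ K) (measurable_coarseObs F 1 ℰp measurableE_ℰp Cs)
          (abs_coarseObs_le_one F 1 ℰp Cs)) (T4VarianceMatching.integrable_of_abs_le (μ K)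
          (measurable_coarseObs F 1 ℰ' hE' Cs) (abs_coarseObs_le_one F 1 ℰ' Cs))]
    _ ≤ ∫ u, |coarseObs F 1 ℰp Cs u - coarseObs F 1 ℰ' Cs u| ∂μ K := abs_integral_le_integral_abs
    _ ≤ ∫ u, N.indicator (fun _ => (2 : ℝ)) u ∂μ K :=
        integral_mono hint.abs ((integrable_const (2 : ℝ)).indicator hNm) hptw
    _ = 2 * (μ K).real N := by
        rw [integral_indicator_const _ hNm, smul_eq_mul, mul_comm]
    _ ≤ 2 * (ε / 2) := by
        refine mul_le_mul_of_nonneg_left ?_ zero_le_two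
        exact hcollar
    _ = ε := by ring

end Main

end Summit.QuantumFields.YangMills.Theorems.GuardedTransfer

end
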